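import Literature.Analysis.FluidPDE.BiotSavartGradient
import HarnessLib

/-!
# Geometric depletion of vortex stretching: the Biot–Savart gradient paired with the direction
# of its own source

Analysis/FluidPDE proof file (theorems only; no definitions, no named facts), first brick of the
discharge of `Literature.Analysis.FluidPDE.constantin_fefferman` (`NSVorticity.lean`;
Constantin–Fefferman, Indiana Univ. Math. J. 42 (1993), Theorem of §1).

The mechanism of Constantin–Fefferman's theorem is the representation of the stretching rate
`α(x) = ⟪ξ, (∇u) ξ⟫`, `ξ = ω/|ω|`, as a singular integral whose kernel carries the geometric factor
`|ξ(x) × ξ(y)| = |sin φ|` (Constantin–Fefferman 1993, §1–§2; Lemarié-Rieusset 2016, proof of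
Thm. 11.7, the identity `𝒜(t, x, y, x) = 0`: "the main point is then the identity
`𝒜̂(t,x,η,x) = 0`", PDF p. 370). We prove it in the following elementary and absolutely convergent
form, for the tree's Biot–Savart kernel `K = biotSavartCLM` (`K(z) h = (4π|z|³)⁻¹ h × z`) and
the tree's gradient formula for the Biot–Savart velocity of a compactly supported Hölder density
(`hasFDerivAt_biotSavart`, Gilbarg–Trudinger (4.9)):

* `inner_biotSavartKernel_smul_self` — `⟪e, K(z)(c e)⟫ = 0` (the triple product `⟪e, e × z⟫`);
* `inner_fderiv_biotSavartCLM_apply_smul_self` — hence `⟪e, (∇K(z) h)(c e)⟫ = 0` for `z ≠ 0`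
  (the function `z ↦ ⟪e, K(z)(c e)⟫` vanishes identically, so does its derivative): **the kernel
  of the stretching rate annihilates sources parallel to the direction `e`**;
* `abs_inner_fderiv_biotSavartCLM_apply_le` — consequently, for a unit vector `e` and any `w`,
  `|⟪e, (∇K(z) e) w⟫| ≤ A ‖w − ⟪w, e⟫ e‖ |z|⁻³`: only the component of `w` orthogonal to `e`
  is seen, and `‖w − ⟪w, e⟫e‖ = |w| |sin ∠(w, e)|` (`A` the size constant of the `C¹` singular
  kernel `K`, `exists_isC1SingularKernel_biotSavartCLM`);
* `exists_abs_inner_fderiv_biotSavart_le` — **the depleted bound for the stretching rate of a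
  Biot–Savart velocity**: if `f : ℝ³ → ℝ³` is Hölder continuous with compact support and `f(x)` is
  parallel to the unit vector `e`, then
  `|⟪e, D(K ∗ f)(x) e⟫| ≤ ∫ g` for every integrable `g` with
  `A ‖f(y) − ⟪f(y), e⟫e‖ |x − y|⁻³ ≤ g(y)` (`y ≠ x`).
  In the gradient formula `D(K∗f)(x)e = ∫(∇K(x−y)e)(f y − χ(y) f x) dy + ∫ ∂ₑχ(y) K(x−y) f(x) dy`
  both cutoff terms drop out after pairing with `e` (they only involve the parallel vector `f x`),
  and the remaining integrand is bounded by the previous item. No principal values and no explicit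
  formula for `∇K` are needed.

With `f` the high-vorticity part of `ω`, `e = ξ(x)`, and Constantin–Fefferman's hypothesis
`√(1 − ⟪ξ(x), ξ(y)⟫²) ≤ |x − y|/ρ` on `{|ω| > Ω}`, the majorant becomes
`A |f(y)| min(1, |x−y|/ρ) |x−y|⁻³`, an integrable kernel against `|f|` — the use made of this file
in `ConstantinFeffermanStretching.lean`.

## Mathlib / tree search

Tree (used): `biotSavartCLM`, `exists_isC1SingularKernel_biotSavartCLM`, `hasFDerivAt_biotSavart`,
`gradPotential`, `integrable_gradIntegrand`, `suppCutoff` (`BiotSavartGradient`,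
`SingularKernelGradient`, `SingularKernelTruncation`); `biotSavartKernel_eq_smul_crossCLM`-style
unfolding (`Vorticity`, `VectorCalculus`). `lean search 'stretchingRate'`: `StretchingRate.lean`
defines `α = ⟪ξ, Dv ξ⟫` and proves `|α| ≤ ‖Dv‖` only — no nonlocal representation or depletion.
Mathlib: `ContinuousLinearMap.integral_apply`, `integral_inner`, `norm_integral_le_of_norm_le`.

## References

* P. Constantin, C. Fefferman, *Direction of vorticity and the problem of global regularity for
  the Navier–Stokes equations*, Indiana Univ. Math. J. 42 (1993), 775–789, §1–§2 (the
  representation of `α` and the factor `|sin φ|`). [ConstantinFeffermanIndiana1993]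
* P. G. Lemarié-Rieusset, *The Navier–Stokes Problem in the 21st Century*, CRC Press (2016),
  §11.6, Thm. 11.7 and its proof (PDF pp. 369–371). [LemarieRieusset2016]
* D. Gilbarg, N. S. Trudinger, *Elliptic PDE of Second Order* (2001), Lemma 4.2, (4.9).
-/

noncomputable section

open MeasureTheory Set Function Filter Metric Real InnerProductSpace
open _root_.Topology
open scoped ENNReal NNReal RealInnerProductSpace

namespace Literature.Analysis.FluidPDE

/-! ### Algebra: the kernel annihilates sources parallel to the pairing direction -/

/-- `⟪e, e × z⟫ = 0` (the triple product with a repeated entry). [folklore] -/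
theorem inner_self_cross (e z : (EuclideanSpace ℝ (Fin 3))) : ⟪e, cross e z⟫ = 0 := by
  simp only [cross, PiLp.inner_apply, RCLike.inner_apply, conj_trivial, Fin.sum_univ_three,
    cross_apply, Matrix.cons_val_zero, Matrix.cons_val_one, Matrix.cons_val_two,
    Matrix.head_cons, Matrix.tail_cons]
  ring

/-- **`⟪e, K(z)(c e)⟫ = 0`**: the Biot–Savart kernel `K(z) h = (4π|z|³)⁻¹ h × z` applied to a
vector parallel to `e` is orthogonal to `e`. [folklore] -/
theorem inner_biotSavartKernel_smul_self (z e : (EuclideanSpace ℝ (Fin 3))) (c : ℝ) :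
    ⟪e, biotSavartKernel z (c • e)⟫ = 0 := by
  have h1 : cross (c • e) z = c • cross e z := by
    rw [← crossCLM_apply, ← crossCLM_apply, map_smul, smul_apply]
  rw [biotSavartKernel, real_inner_smul_right, h1, real_inner_smul_right, inner_self_cross, mul_zero,
    mul_zero]

/-- **The kernel of the stretching rate annihilates parallel sources**: for `z ≠ 0` and all
`h`, `⟪e, (∇K(z) h)(c e)⟫ = 0` — the scalar function `z ↦ ⟪e, K(z)(c e)⟫` vanishes identically,
hence so does its derivative (Lemarié-Rieusset 2016, proof of Thm. 11.7: `𝒜(t, x, y, x) = 0`). [cite: LemarieRieusset2016, Thm. 11.7 (proof, PDF p. 370)] -/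
theorem inner_fderiv_biotSavartCLM_apply_smul_self {z : (EuclideanSpace ℝ (Fin 3))} (hz : z ≠ 0) (e h : (EuclideanSpace ℝ (Fin 3))) (c : ℝ) :
    ⟪e, (fderiv ℝ biotSavartCLM z h) (c • e)⟫ = 0 := by
  obtain ⟨A, hK⟩ := exists_isC1SingularKernel_biotSavartCLM
  have hd : DifferentiableAt ℝ biotSavartCLM z := (hK.contDiffAt z hz).differentiableAt one_ne_zero
  -- the continuous linear functional `ℓ L = ⟪e, L (c • e)⟫` on `ℝ³ →L[ℝ] ℝ³`
  set ℓ : ((EuclideanSpace ℝ (Fin 3)) →L[ℝ] (EuclideanSpace ℝ (Fin 3))) →L[ℝ] ℝ :=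
    (innerSL ℝ e).comp (ContinuousLinearMap.apply ℝ (EuclideanSpace ℝ (Fin 3)) (c • e)) with hℓ
  have hℓapp : ∀ L : (EuclideanSpace ℝ (Fin 3)) →L[ℝ] (EuclideanSpace ℝ (Fin 3)), ℓ L = ⟪e, L (c • e)⟫ := fun L => by
    simp only [hℓ, ContinuousLinearMap.comp_apply, ContinuousLinearMap.apply_apply, innerSL_apply_apply]
  have hφ : (fun w => ℓ (biotSavartCLM w)) = fun _ => (0 : ℝ) := by
    funext w
    rw [hℓapp, biotSavartCLM_apply]
    exact inner_biotSavartKernel_smul_self w e c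
  have h1 : HasFDerivAt (fun w => ℓ (biotSavartCLM w)) (ℓ.comp (fderiv ℝ biotSavartCLM z)) z :=
    ℓ.hasFDerivAt.comp z hd.hasFDerivAt
  have h2 : fderiv ℝ (fun w => ℓ (biotSavartCLM w)) z = 0 := by
    rw [hφ]
    simp
  have h3 : ℓ.comp (fderiv ℝ biotSavartCLM z) = 0 := by rw [← h1.fderiv, h2]
  have h4 := congrArg (fun L : (EuclideanSpace ℝ (Fin 3)) →L[ℝ] ℝ => L h) h3
  simp only [ContinuousLinearMap.comp_apply, zero_apply] at h4
  rwa [hℓapp] at h4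

/-- **The depleted kernel bound**: for a unit vector `e`, `z ≠ 0` and any `w`,
`|⟪e, (∇K(z) e) w⟫| ≤ A ‖w − ⟪w, e⟫ e‖ |z|⁻³`, `A` the size constant of the `C¹` singular kernel
`K` (`‖∇K(z)‖ ≤ A|z|⁻³`): the component of `w` along `e` is annihilated, and
`‖w − ⟪w, e⟫e‖ = |w| |sin ∠(w, e)|` is Constantin–Fefferman's geometric factor. [cite: ConstantinFeffermanIndiana1993, §2 (the kernel estimate with the factor |sin φ|)] -/
theorem abs_inner_fderiv_biotSavartCLM_apply_le {A : ℝ} (hK : IsC1SingularKernel biotSavartCLM A)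
    {z : (EuclideanSpace ℝ (Fin 3))} (hz : z ≠ 0) {e : (EuclideanSpace ℝ (Fin 3))} (he : ‖e‖ = 1) (w : (EuclideanSpace ℝ (Fin 3))) :
    |⟪e, (fderiv ℝ biotSavartCLM z e) w⟫| ≤ A * ‖w - ⟪w, e⟫ • e‖ * (‖z‖ ^ 3)⁻¹ := by
  have hsplit : w = (w - ⟪w, e⟫ • e) + ⟪w, e⟫ • e := (sub_add_cancel w _).symm
  have h0 : ⟪e, (fderiv ℝ biotSavartCLM z e) (⟪w, e⟫ • e)⟫ = 0 :=
    inner_fderiv_biotSavartCLM_apply_smul_self hz e e ⟪w, e⟫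
  have heq : ⟪e, (fderiv ℝ biotSavartCLM z e) w⟫ =
      ⟪e, (fderiv ℝ biotSavartCLM z e) (w - ⟪w, e⟫ • e)⟫ := by
    conv_lhs => rw [hsplit]
    rw [map_add, inner_add_right, h0, add_zero]
  rw [heq]
  calc |⟪e, (fderiv ℝ biotSavartCLM z e) (w - ⟪w, e⟫ • e)⟫|
      ≤ ‖e‖ * ‖(fderiv ℝ biotSavartCLM z e) (w - ⟪w, e⟫ • e)‖ := abs_real_inner_le_norm _ _
    _ ≤ ‖e‖ * (‖fderiv ℝ biotSavartCLM z e‖ * ‖w - ⟪w, e⟫ • e‖) := by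
        gcongr
        exact ContinuousLinearMap.le_opNorm _ _
    _ ≤ ‖e‖ * ((‖fderiv ℝ biotSavartCLM z‖ * ‖e‖) * ‖w - ⟪w, e⟫ • e‖) := by
        gcongr
        exact ContinuousLinearMap.le_opNorm _ _
    _ ≤ 1 * ((A * (‖z‖ ^ 3)⁻¹ * 1) * ‖w - ⟪w, e⟫ • e‖) := by
        rw [he]
        gcongr
        exact hK.norm_fderiv_le z hz
    _ = A * ‖w - ⟪w, e⟫ • e‖ * (‖z‖ ^ 3)⁻¹ := by ring

/-! ### The depleted bound for the stretching rate of a Biot–Savart velocity -/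

/-- **Geometric depletion of the stretching rate** (Constantin–Fefferman 1993, §2;
Lemarié-Rieusset 2016, proof of Thm. 11.7). There is an absolute constant `A ≥ 0` such that: if
`f : ℝ³ → ℝ³` is `γ`-Hölder (`γ > 0`) with compact support, `e` is a unit vector and `f(x)` is
parallel to `e`, then for every integrable `g : ℝ³ → ℝ` dominating the depleted kernel,
`A ‖f(y) − ⟪f(y), e⟫e‖ |x − y|⁻³ ≤ g(y)` for `y ≠ x`, the stretching rate of the Biot–Savart velocity
`v = K ∗ f` at `x` in the direction `e` satisfies `|⟪e, Dv(x) e⟫| ≤ ∫ g`.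
Proof: by the gradient formula `hasFDerivAt_biotSavart`,
`Dv(x)e = ∫(∇K(x−y)e)(f y − χ(y) f x) dy + ∫ ∂ₑχ(y) K(x−y) f(x) dy`; pairing with `e` kills `f x`
everywhere (`inner_fderiv_biotSavartCLM_apply_smul_self`, `inner_biotSavartKernel_smul_self`), and
`|⟪e, (∇K(x−y)e)(f y)⟫| ≤ A‖f(y) − ⟪f(y),e⟫e‖|x−y|⁻³` (`abs_inner_fderiv_biotSavartCLM_apply_le`). [cite: ConstantinFeffermanIndiana1993, §2; LemarieRieusset2016, Thm. 11.7 (proof, PDF pp. 370–371)] -/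
theorem exists_abs_inner_fderiv_biotSavart_le :
    ∃ A : ℝ, 0 ≤ A ∧ ∀ ⦃γ C : ℝ≥0⦄ (_ : 0 < γ) ⦃f : (EuclideanSpace ℝ (Fin 3)) → (EuclideanSpace ℝ (Fin 3))⦄ (_ : HolderWith C γ f)
      (_ : HasCompactSupport f) ⦃x e : (EuclideanSpace ℝ (Fin 3))⦄ (_ : ‖e‖ = 1) (_ : ∃ c : ℝ, f x = c • e)
      ⦃g : (EuclideanSpace ℝ (Fin 3)) → ℝ⦄ (_ : Integrable g)
      (_ : ∀ y, y ≠ x → A * ‖f y - ⟪f y, e⟫ • e‖ * (‖x - y‖ ^ 3)⁻¹ ≤ g y),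
      |⟪e, fderiv ℝ (biotSavart f) x e⟫| ≤ ∫ y, g y := by
  obtain ⟨A, hK⟩ := exists_isC1SingularKernel_biotSavartCLM
  refine ⟨A, hK.nonneg, ?_⟩
  intro γ C hγ f hf hfc x e he hpar g hg hdom
  obtain ⟨c, hc⟩ := hpar
  -- a ball around `x` containing the support
  obtain ⟨R, hR⟩ := hfc.isCompact.isBounded.subset_closedBall (0 : (EuclideanSpace ℝ (Fin 3)))
  set ρ : ℝ := |R| + ‖x‖ + 1 with hρdef
  have hρ : 0 < ρ := by positivity
  have hsupp : tsupport f ⊆ closedBall x ρ := by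
    intro y hy
    have hy' : ‖y‖ ≤ R := mem_closedBall_zero_iff.1 (hR hy)
    rw [mem_closedBall, dist_eq_norm]
    calc ‖y - x‖ ≤ ‖y‖ + ‖x‖ := norm_sub_le _ _
      _ ≤ |R| + ‖x‖ + 1 := by linarith [le_abs_self R]
  have hx : ‖x - x‖ < ρ / 2 := by rw [sub_self, norm_zero]; positivity
  -- the gradient formula
  have hD : fderiv ℝ (biotSavart f) x = gradPotential biotSavartCLM x ρ f x :=
    (hasFDerivAt_biotSavart hγ hf hρ hsupp hx).fderiv
  set F₁ : (EuclideanSpace ℝ (Fin 3)) → (EuclideanSpace ℝ (Fin 3)) →L[ℝ] (EuclideanSpace ℝ (Fin 3)) := fun y =>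
    (fderiv ℝ biotSavartCLM (x - y)).flip (f y - suppCutoff x ρ y • f x) with hF₁
  set F₂ : (EuclideanSpace ℝ (Fin 3)) → (EuclideanSpace ℝ (Fin 3)) →L[ℝ] (EuclideanSpace ℝ (Fin 3)) := fun y =>
    (fderiv ℝ (suppCutoff x ρ) y).smulRight (biotSavartCLM (x - y) (f x)) with hF₂
  have hgrad : gradPotential biotSavartCLM x ρ f x = (∫ y, F₁ y) + ∫ y, F₂ y := rfl
  have hF₁i : Integrable F₁ := integrable_gradIntegrand hK hγ hf hρ hsupp hx
  -- the cutoff term drops out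
  have h2 : ⟪e, (∫ y, F₂ y) e⟫ = 0 := by
    by_cases hF₂i : Integrable F₂
    · rw [ContinuousLinearMap.integral_apply hF₂i, ← integral_inner (hF₂i.apply_continuousLinearMap e)]
      refine integral_eq_zero_of_ae (Eventually.of_forall fun y => ?_)
      simp only [hF₂, ContinuousLinearMap.smulRight_apply, real_inner_smul_right, biotSavartCLM_apply,
        hc, inner_biotSavartKernel_smul_self, mul_zero, Pi.zero_apply]
    · rw [integral_undef hF₂i, zero_apply, inner_zero_right]
  -- the singular term: pointwise identification off the diagonal and the depleted bound
  have hpt : ∀ y, y ≠ x → ⟪e, F₁ y e⟫ = ⟪e, (fderiv ℝ biotSavartCLM (x - y) e) (f y)⟫ := by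
    intro y hy
    have hz : x - y ≠ 0 := sub_ne_zero.2 (Ne.symm hy)
    show ⟪e, ((fderiv ℝ biotSavartCLM (x - y)).flip (f y - suppCutoff x ρ y • f x)) e⟫ = _
    rw [ContinuousLinearMap.flip_apply, map_sub, map_smul, inner_sub_right, real_inner_smul_right, hc,
      inner_fderiv_biotSavartCLM_apply_smul_self hz, mul_zero, sub_zero]
  have hae : ∀ᵐ y ∂(volume : Measure (EuclideanSpace ℝ (Fin 3))), ‖⟪e, F₁ y e⟫‖ ≤ g y := by
    have hne : ∀ᵐ y ∂(volume : Measure (EuclideanSpace ℝ (Fin 3))), y ≠ x := by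
      simp [ae_iff, measure_singleton]
    filter_upwards [hne] with y hy
    rw [hpt y hy, Real.norm_eq_abs]
    exact (abs_inner_fderiv_biotSavartCLM_apply_le hK (sub_ne_zero.2 (Ne.symm hy)) he (f y)).trans
      (hdom y hy)
  have h1 : |⟪e, (∫ y, F₁ y) e⟫| ≤ ∫ y, g y := by
    rw [ContinuousLinearMap.integral_apply hF₁i, ← integral_inner (hF₁i.apply_continuousLinearMap e),
      ← Real.norm_eq_abs]
    exact norm_integral_le_of_norm_le hg hae
  -- assemble
  rw [hD, hgrad, _root_.add_apply, inner_add_right, h2, add_zero]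
  exact h1

end Literature.Analysis.FluidPDE

end
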